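import Mathlib.Topology.Algebra.OpenSubgroup
import Mathlib.GroupTheory.Index
import Mathlib.GroupTheory.Coset.Basic
import Mathlib.Algebra.BigOperators.Finprod
import Mathlib.Topology.Algebra.Group.Compact
import Mathlib.Analysis.Complex.Basic
import HarnessLib

/-!
# The left-invariant integral of compactly supported smooth vector-valued functions (finite sums)

Infrastructure for the theory of compact representations (Bernstein–Zelevinsky 1976, §2.4;
Casselman 1995, §2.1 "the integral is essentially a finite sum"): for a group `G` with a fixed
subgroup `K₀` (normalisation `vol K₀ = 1`, in practice compact open) and a vector space `Y` over a
field `k` of characteristic `0` (no topology on `Y`), the **integral**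
`∫_G φ = [K₀ : K]⁻¹ • ∑_{x ∈ G/K} φ(x)` of a function `φ : G → Y` which is right `K`-invariant for a
subgroup `K ≤ K₀` of finite index and supported on finitely many cosets `x K`
(`IsAdapted K₀ K φ`). We define it relative to an explicit level `K` (`lcInt K₀ K φ`) and prove
independence of the level (`IsAdapted.lcInt_eq_of_le`, `IsAdapted.lcInt_eq`), linearity
(`IsAdapted.lcInt_add`, `lcInt_smul`), compatibility with linear maps (`IsAdapted.map_lcInt`),
**left invariance** `∫ φ(g ·) = ∫ φ` (`IsAdapted.lcInt_comp_mul_left`) and, over `ℂ`, positivity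
(`IsAdapted.re_lcInt_pos`). Only left invariance is proved (and needed downstream); no
unimodularity, no measure theory. One structure of hypotheses and one definition; no named facts.

## References

* I. N. Bernstein, A. V. Zelevinsky, *Representations of the group `GL(n, F)` where `F` is a
  non-archimedean local field*, Russian Math. Surveys 31:3 (1976), §1, §2.4.
* W. Casselman, *Introduction to the theory of admissible representations of `p`-adic reductive
  groups* (1995 notes), §2.1.
-/

noncomputable section

open scoped Pointwise

namespace Literature.NumberTheory.Automorphic.LcIntegral

section Defs

variable {k G Y : Type*} [Field k] [Group G] [AddCommGroup Y] [Module k Y]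
  (K₀ K : Subgroup G) (φ : G → Y)

/-- `φ : G → Y` is **adapted to the level `K ≤ K₀`**: `K` has finite index in `K₀`, `φ` is right
`K`-invariant and is supported on finitely many cosets `x K`. (For `K₀` compact open, `K` open and
`φ` locally constant with compact support this holds; we record exactly what the finite-sum
integral consumes.) [folklore] -/
structure IsAdapted : Prop where
  le : K ≤ K₀
  relIndex_ne_zero : K.relIndex K₀ ≠ 0
  mul_right : ∀ (g κ : G), κ ∈ K → φ (g * κ) = φ g
  finite : (Function.support fun x : G ⧸ K => φ x.out).Finite

/-- The **integral** of `φ` computed at level `K`: `[K₀ : K]⁻¹ • ∑_{x ∈ G/K} φ(x̃)` (a `finsum`;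
meaningful when `IsAdapted K₀ K φ`). For `G` locally profinite, `K₀` compact open and `φ` locally
constant of compact support this is `∫_G φ(g) dg` for the left Haar measure with `vol K₀ = 1`.
(Bernstein–Zelevinsky 1976, §1; Casselman 1995, §2.1.) [folklore] -/
def lcInt : Y := ((K.relIndex K₀ : ℕ) : k)⁻¹ • ∑ᶠ x : G ⧸ K, φ x.out

variable {K₀ K φ}

omit [AddCommGroup Y] [Module k Y] in
/-- A right `K`-invariant function takes the same value on `(g K)~` and `g`. [folklore] -/
theorem apply_out_mk (hmul : ∀ (g κ : G), κ ∈ K → φ (g * κ) = φ g) (g : G) :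
    φ (QuotientGroup.mk (s := K) g).out = φ g := by
  obtain ⟨κ, hκ⟩ := QuotientGroup.mk_out_eq_mul K g
  rw [hκ, hmul g κ κ.2]

/-- The integral at level `K` as a sum over any finite set of cosets containing the support. [folklore] -/
theorem lcInt_eq_sum {s : Finset (G ⧸ K)} (hs : ∀ x : G ⧸ K, φ x.out ≠ 0 → x ∈ s) :
    lcInt (k := k) K₀ K φ = ((K.relIndex K₀ : ℕ) : k)⁻¹ • ∑ x ∈ s, φ x.out := by
  rw [lcInt, finsum_eq_sum_of_support_subset _ (fun x hx => ?_)]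
  exact Finset.mem_coe.2 (hs x hx)

/-- The zero function is adapted to every level of finite index. [folklore] -/
theorem isAdapted_zero (hK : K ≤ K₀) (hi : K.relIndex K₀ ≠ 0) : IsAdapted K₀ K (0 : G → Y) where
  le := hK
  relIndex_ne_zero := hi
  mul_right _ _ _ := rfl
  finite := by simp

/-- The integral of `0` is `0`. [folklore] -/
@[simp] theorem lcInt_zero : lcInt (k := k) K₀ K (0 : G → Y) = 0 := by simp [lcInt]

/-- Adaptedness is stable under addition (same level). [folklore] -/
theorem IsAdapted.add {ψ : G → Y} (hφ : IsAdapted K₀ K φ) (hψ : IsAdapted K₀ K ψ) :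
    IsAdapted K₀ K (φ + ψ) where
  le := hφ.le
  relIndex_ne_zero := hφ.relIndex_ne_zero
  mul_right g κ hκ := by rw [Pi.add_apply, Pi.add_apply, hφ.mul_right g κ hκ, hψ.mul_right g κ hκ]
  finite := (hφ.finite.union hψ.finite).subset (Function.support_add _ _)

/-- Adaptedness is stable under scalars. [folklore] -/
theorem IsAdapted.smul {R : Type*} [Monoid R] [DistribMulAction R Y] (c : R) (hφ : IsAdapted K₀ K φ) :
    IsAdapted K₀ K (c • φ) where
  le := hφ.le
  relIndex_ne_zero := hφ.relIndex_ne_zero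
  mul_right g κ hκ := by rw [Pi.smul_apply, Pi.smul_apply, hφ.mul_right g κ hκ]
  finite := hφ.finite.subset (Function.support_const_smul_subset c _)

/-- Adaptedness is stable under post-composition with a linear map. [folklore] -/
theorem IsAdapted.map {Y' : Type*} [AddCommGroup Y'] [Module k Y'] (T : Y →ₗ[k] Y')
    (hφ : IsAdapted K₀ K φ) : IsAdapted K₀ K (T ∘ φ) where
  le := hφ.le
  relIndex_ne_zero := hφ.relIndex_ne_zero
  mul_right g κ hκ := by rw [Function.comp_apply, Function.comp_apply, hφ.mul_right g κ hκ]
  finite := hφ.finite.subset fun x hx => by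
    rw [Function.mem_support] at hx ⊢
    intro h
    exact hx (by rw [Function.comp_apply, h, map_zero])

/-- **Additivity** of the integral (same level). [folklore] -/
theorem IsAdapted.lcInt_add {ψ : G → Y} (hφ : IsAdapted K₀ K φ) (hψ : IsAdapted K₀ K ψ) :
    lcInt (k := k) K₀ K (φ + ψ) = lcInt (k := k) K₀ K φ + lcInt (k := k) K₀ K ψ := by
  rw [lcInt, lcInt, lcInt, ← smul_add, ← finsum_add_distrib hφ.finite hψ.finite]
  rfl

/-- **Homogeneity** of the integral. [folklore] -/
theorem IsAdapted.lcInt_smul {R : Type*} [Monoid R] [DistribMulAction R Y] [SMulCommClass R k Y] (c : R)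
    (hφ : IsAdapted K₀ K φ) : lcInt (k := k) K₀ K (c • φ) = c • lcInt (k := k) K₀ K φ := by
  rw [lcInt, lcInt, smul_comm, smul_finsum' c hφ.finite]
  rfl

/-- **Linear maps commute with the integral**: `T (∫ φ) = ∫ T ∘ φ`. [folklore] -/
theorem IsAdapted.map_lcInt {Y' : Type*} [AddCommGroup Y'] [Module k Y'] (T : Y →ₗ[k] Y')
    (hφ : IsAdapted K₀ K φ) : T (lcInt (k := k) K₀ K φ) = lcInt (k := k) K₀ K (T ∘ φ) := by
  rw [lcInt, lcInt, map_smul]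
  congr 1
  exact AddMonoidHom.map_finsum T.toAddMonoidHom hφ.finite

end Defs

/-! ### Independence of the level -/

section Level

variable {k G Y : Type*} [Field k] [CharZero k] [Group G] [AddCommGroup Y] [Module k Y]
  {K₀ K : Subgroup G} {φ : G → Y}

/-- If `K' ≤ K ≤ K₀` and `K'` has finite index in `K₀` then `K'` has finite index in `K`. [folklore] -/
theorem relIndex_ne_zero_of_le {K' : Subgroup G} (hK'K : K' ≤ K) (hK : K ≤ K₀)
    (hK' : K'.relIndex K₀ ≠ 0) : K'.relIndex K ≠ 0 := by
  intro h
  apply hK'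
  rw [← Subgroup.relIndex_mul_relIndex K' K K₀ hK'K hK, h, zero_mul]

omit [CharZero k] [AddCommGroup Y] [Module k Y] in
/-- The value of `φ` at a representative of the finer coset corresponding to `(q, r)`,
`q ∈ G/K`, `r ∈ K/K'`, is `φ(q̃)`. [folklore] -/
theorem apply_out_symm_quotientEquivProdOfLE {K' : Subgroup G} (hK'K : K' ≤ K)
    (hmul : ∀ (g κ : G), κ ∈ K → φ (g * κ) = φ g) (p : (G ⧸ K) × (K ⧸ K'.subgroupOf K)) :
    φ ((Subgroup.quotientEquivProdOfLE hK'K).symm p).out = φ p.1.out := by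
  obtain ⟨q, r⟩ := p
  induction r using QuotientGroup.induction_on with
  | H b =>
    rw [Subgroup.quotientEquivProdOfLE_symm_apply]
    change φ (Quotient.mk'' (q.out * (b : G)) : G ⧸ K').out = φ q.out
    rw [show (Quotient.mk'' (q.out * (b : G)) : G ⧸ K') = QuotientGroup.mk (q.out * (b : G)) from rfl,
      apply_out_mk (fun g κ hκ => hmul g κ (hK'K hκ)), hmul _ _ b.2]

/-- **Independence of the level (refinement)**: the integral computed at a finer level `K' ≤ K`
(of finite index in `K₀`) equals the integral at level `K`: each coset `x K` splits into
`[K : K']` cosets of `K'` on which `φ` is constant, and `[K₀ : K'] = [K₀ : K][K : K']`. [folklore] -/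
theorem IsAdapted.lcInt_eq_of_le (h : IsAdapted K₀ K φ) {K' : Subgroup G} (hK'K : K' ≤ K)
    (hK' : K'.relIndex K₀ ≠ 0) : lcInt (k := k) K₀ K' φ = lcInt (k := k) K₀ K φ := by
  classical
  have hKK : K'.relIndex K ≠ 0 := relIndex_ne_zero_of_le hK'K h.le hK'
  haveI : (K'.subgroupOf K).FiniteIndex := ⟨hKK⟩
  haveI : Fintype (K ⧸ K'.subgroupOf K) := Fintype.ofFinite _
  set e := Subgroup.quotientEquivProdOfLE hK'K with he
  -- rewrite the sum at level `K'` along `e`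
  have hval : ∀ p : (G ⧸ K) × (K ⧸ K'.subgroupOf K), φ (e.symm p).out = φ p.1.out :=
    apply_out_symm_quotientEquivProdOfLE hK'K h.mul_right
  have hsupp : (Function.support fun p : (G ⧸ K) × (K ⧸ K'.subgroupOf K) => φ p.1.out).Finite := by
    refine (h.finite.prod (Set.finite_univ (α := K ⧸ K'.subgroupOf K))).subset ?_
    intro p hp
    exact ⟨hp, Set.mem_univ _⟩
  have h1 : ∑ᶠ x : G ⧸ K', φ x.out = ∑ᶠ p : (G ⧸ K) × (K ⧸ K'.subgroupOf K), φ p.1.out := by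
    rw [← finsum_comp_equiv e.symm]
    exact finsum_congr hval
  have h2 : ∑ᶠ p : (G ⧸ K) × (K ⧸ K'.subgroupOf K), φ p.1.out =
      (K'.relIndex K : k) • ∑ᶠ q : G ⧸ K, φ q.out := by
    rw [finsum_curry _ hsupp]
    simp only [finsum_eq_sum_of_fintype, Finset.sum_const, Finset.card_univ]
    rw [smul_finsum' _ h.finite]  -- may need adjustment
    refine finsum_congr fun q => ?_
    rw [← Nat.cast_smul_eq_nsmul k, Subgroup.relIndex, Subgroup.index_eq_card, Nat.card_eq_fintype_card]
  rw [lcInt, lcInt, h1, h2, smul_smul]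
  congr 1
  rw [← Subgroup.relIndex_mul_relIndex K' K K₀ hK'K h.le, Nat.cast_mul, mul_inv, mul_assoc, mul_left_comm,
    inv_mul_cancel₀ (Nat.cast_ne_zero.2 hKK : (K'.relIndex K : k) ≠ 0), mul_one]

/-- Refining the level preserves adaptedness. [folklore] -/
theorem IsAdapted.of_le (h : IsAdapted K₀ K φ) {K' : Subgroup G} (hK'K : K' ≤ K)
    (hK' : K'.relIndex K₀ ≠ 0) : IsAdapted K₀ K' φ where
  le := hK'K.trans h.le
  relIndex_ne_zero := hK'
  mul_right g κ hκ := h.mul_right g κ (hK'K hκ)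
  finite := by
    haveI : (K'.subgroupOf K).FiniteIndex := ⟨relIndex_ne_zero_of_le hK'K h.le hK'⟩
    set e := Subgroup.quotientEquivProdOfLE hK'K with he
    have hsub : (Function.support fun x : G ⧸ K' => φ x.out) ⊆
        e ⁻¹' ((Function.support fun q : G ⧸ K => φ q.out) ×ˢ Set.univ) := by
      intro x hx
      refine ⟨?_, Set.mem_univ _⟩
      rw [Function.mem_support] at hx ⊢
      have := apply_out_symm_quotientEquivProdOfLE hK'K h.mul_right (e x)
      rw [Equiv.symm_apply_apply] at this
      rwa [← this]
    exact ((h.finite.prod Set.finite_univ).preimage e.injective.injOn).subset hsub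

/-- **Independence of the level**: two levels to which `φ` is adapted give the same integral
(compare both with `K ∩ K'`). [folklore] -/
theorem IsAdapted.lcInt_eq {K' : Subgroup G} (h : IsAdapted K₀ K φ) (h' : IsAdapted K₀ K' φ) :
    lcInt (k := k) K₀ K φ = lcInt (k := k) K₀ K' φ := by
  have hi : (K ⊓ K').relIndex K₀ ≠ 0 := by
    have := Subgroup.relIndex_inf_ne_zero h.relIndex_ne_zero h'.relIndex_ne_zero
    exact this
  rw [← h.lcInt_eq_of_le inf_le_left hi, ← h'.lcInt_eq_of_le inf_le_right hi]

end Level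

/-! ### Left invariance -/

section LeftInvariance

variable {k G Y : Type*} [Field k] [Group G] [AddCommGroup Y] [Module k Y]
  {K₀ K : Subgroup G} {φ : G → Y}

omit [AddCommGroup Y] [Module k Y] in
/-- For right `K`-invariant `φ`: `φ (g x̃) = φ ((g • x)~)`. [folklore] -/
theorem apply_mul_out (hmul : ∀ (g κ : G), κ ∈ K → φ (g * κ) = φ g) (g : G) (x : G ⧸ K) :
    φ (g * x.out) = φ (g • x).out := by
  rw [← apply_out_mk hmul (g * x.out), ← smul_eq_mul, MulAction.Quotient.mk_smul_out]

/-- Left translates of adapted functions are adapted (same level). [folklore] -/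
theorem IsAdapted.comp_mul_left (h : IsAdapted K₀ K φ) (g : G) : IsAdapted K₀ K fun x => φ (g * x) where
  le := h.le
  relIndex_ne_zero := h.relIndex_ne_zero
  mul_right x κ hκ := by rw [← mul_assoc, h.mul_right _ κ hκ]
  finite := by
    have hsub : (Function.support fun x : G ⧸ K => φ (g * x.out)) ⊆
        (fun x : G ⧸ K => g • x) ⁻¹' (Function.support fun x : G ⧸ K => φ x.out) := by
      intro x hx
      rw [Set.mem_preimage, Function.mem_support] at *
      rwa [← apply_mul_out h.mul_right g x]
    exact (h.finite.preimage (MulAction.injective g).injOn).subset hsub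

/-- **Left invariance of the integral**: `∫ φ(g x) dx = ∫ φ(x) dx` (the translation permutes the
cosets `x K`). (Bernstein–Zelevinsky 1976, §1.) [folklore] -/
theorem IsAdapted.lcInt_comp_mul_left (h : IsAdapted K₀ K φ) (g : G) :
    lcInt (k := k) K₀ K (fun x => φ (g * x)) = lcInt (k := k) K₀ K φ := by
  rw [lcInt, lcInt]
  congr 1
  calc ∑ᶠ x : G ⧸ K, φ (g * x.out) = ∑ᶠ x : G ⧸ K, φ ((MulAction.toPerm g : Equiv.Perm (G ⧸ K)) x).out :=
        finsum_congr fun x => apply_mul_out h.mul_right g x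
    _ = ∑ᶠ x : G ⧸ K, φ x.out := finsum_comp_equiv (MulAction.toPerm g) (f := fun x : G ⧸ K => φ x.out)

end LeftInvariance

/-! ### Positivity over `ℂ` -/

section Positivity

variable {G : Type*} [Group G] {K₀ K : Subgroup G} {φ : G → ℂ}

/-- **Positivity**: if `φ : G → ℂ` is adapted, takes values in the non-negative reals, and
`φ 1 ≠ 0`, then `∫ φ` has positive real part (in particular `∫ φ ≠ 0`): the coset of `1`
contributes `[K₀ : K]⁻¹ φ(1) > 0` and all other terms are `≥ 0`. [folklore] -/
theorem IsAdapted.re_lcInt_pos (h : IsAdapted K₀ K φ) (hre : ∀ g, 0 ≤ (φ g).re)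
    (him : ∀ g, (φ g).im = 0) (h1 : φ 1 ≠ 0) : 0 < (lcInt (k := ℂ) K₀ K φ).re := by
  classical
  obtain ⟨s, hs⟩ : ∃ s : Finset (G ⧸ K), ∀ x : G ⧸ K, φ x.out ≠ 0 → x ∈ s :=
    ⟨h.finite.toFinset, fun x hx => h.finite.mem_toFinset.2 hx⟩
  have hsc : ((K.relIndex K₀ : ℕ) : ℂ)⁻¹ = ((((K.relIndex K₀ : ℕ) : ℝ)⁻¹ : ℝ) : ℂ) := by
    rw [Complex.ofReal_inv, Complex.ofReal_natCast]
  rw [lcInt_eq_sum hs, smul_eq_mul, hsc, Complex.re_ofReal_mul]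
  refine mul_pos ?_ ?_
  · exact inv_pos.2 (Nat.cast_pos.2 (Nat.pos_of_ne_zero h.relIndex_ne_zero))
  · rw [Complex.re_sum]
    have h1' : φ (QuotientGroup.mk (s := K) (1 : G)).out ≠ 0 := by
      rwa [apply_out_mk h.mul_right]
    have hmem : (QuotientGroup.mk (s := K) (1 : G)) ∈ s := hs _ h1'
    refine Finset.sum_pos' (fun x _ => hre _) ⟨_, hmem, ?_⟩
    have hz : φ (QuotientGroup.mk (s := K) (1 : G)).out = ((φ (QuotientGroup.mk (s := K) (1 : G)).out).re : ℂ) :=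
      Complex.ext rfl (by rw [Complex.ofReal_im, him])
    rcases (hre (QuotientGroup.mk (s := K) (1 : G)).out).lt_or_eq with hlt | heq
    · exact hlt
    · exfalso
      apply h1'
      rw [hz, ← heq, Complex.ofReal_zero]

/-- The integral of an adapted non-negative real-valued `φ` with `φ 1 ≠ 0` is non-zero. [folklore] -/
theorem IsAdapted.lcInt_ne_zero (h : IsAdapted K₀ K φ) (hre : ∀ g, 0 ≤ (φ g).re)
    (him : ∀ g, (φ g).im = 0) (h1 : φ 1 ≠ 0) : lcInt (k := ℂ) K₀ K φ ≠ 0 := fun h0 => by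
  have := h.re_lcInt_pos hre him h1
  rw [h0, Complex.zero_re] at this
  exact lt_irrefl _ this

end Positivity

/-! ### Adaptedness from compact support and local constancy -/

section Topology

variable {k G Y : Type*} [Field k] [Group G] [TopologicalSpace G] [IsTopologicalGroup G]
  [AddCommGroup Y] [Module k Y] {K₀ K : Subgroup G} {φ : G → Y}

/-- **Compactly supported right-`K`-invariant functions are adapted**: if `K ≤ K₀` is open, `K₀`
is compact, `φ` is right `K`-invariant and vanishes off a compact set `C`, then `φ` is adapted to
`K` (finitely many cosets `x K` meet `C`). [folklore] -/
theorem isAdapted_of_isCompact (hK : K ≤ K₀) (hKo : IsOpen (K : Set G)) (hK₀ : IsCompact (K₀ : Set G))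
    (hmul : ∀ (g κ : G), κ ∈ K → φ (g * κ) = φ g) {C : Set G} (hC : IsCompact C)
    (hsupp : ∀ g, φ g ≠ 0 → g ∈ C) : IsAdapted K₀ K φ where
  le := hK
  relIndex_ne_zero := by
    haveI : CompactSpace K₀ := isCompact_iff_compactSpace.1 hK₀
    haveI : Finite (K₀ ⧸ K.subgroupOf K₀) :=
      Subgroup.quotient_finite_of_isOpen _ (Subgroup.subgroupOf_isOpen K₀ K hKo)
    haveI : (K.subgroupOf K₀).FiniteIndex := Subgroup.finiteIndex_of_finite_quotient
    exact Subgroup.FiniteIndex.index_ne_zero (H := K.subgroupOf K₀)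
  mul_right := hmul
  finite := by
    -- cover `C` by finitely many cosets `g K`
    obtain ⟨t, ht⟩ := hC.elim_finite_subcover (fun g : G => (g * ·) '' (K : Set G))
      (fun g => isOpenMap_mul_left g _ hKo) (fun x _ => Set.mem_iUnion.2 ⟨x, 1, K.one_mem, mul_one x⟩)
    refine (t.finite_toSet.image (QuotientGroup.mk (s := K))).subset fun x hx => ?_
    rw [Function.mem_support] at hx
    obtain ⟨g, hg, hx'⟩ := Set.mem_iUnion₂.1 (ht (hsupp _ hx))
    obtain ⟨κ, hκ, hgκ⟩ := hx'
    refine ⟨g, hg, ?_⟩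
    rw [← QuotientGroup.out_eq' x, QuotientGroup.eq, ← hgκ]
    simpa using hκ

end Topology

end Literature.NumberTheory.Automorphic.LcIntegral
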